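import Literature.MathematicalPhysics.QuantumFieldTheory.Balaban1983to89.Node00.Record13CarriersSepCoPH
import Literature.MathematicalPhysics.QuantumFieldTheory.Balaban1983to89.Node00.Record13SepCoPRInhabitedOfSepCoP
import Summits.QuantumFields.YangMills.Theorems.BalabanUVNodesN10AtRecord13SepCoPHB13

/-!
# BalabanUVNodes ∕ N10 — N10's SLICE OF THE K1 RUNG 1 `NodesAtSomeRecord13PWS` (v1.7 tokens) AT THE **S-BOUND** [B13]-PINNED WORLD, and THE ⁷ WITNESS LINE AT node00-def-T's DOOR
# `Stage13HParams.ofHistoryBlind` (of any guarded v1.6 package, and of node00-def-K0a's cured lift `ofCured θ₀` of any v1.5 one) — the token-map twin of `…N10AtRecord13SepCoPRSB13`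
# (p534364) under T₇ (Track A, DAG node N10 [B13]; strategy s2 «by-name knit at the record of record»; seat `pub-ymgap-dag-n10-d` g11; director-ym №183 H1ʰ; count-neutral)

HONEST FRAMING.  Count-neutral kernel bookkeeping BY NAME over LANDED modules.  plan's registered rung 1 v4 of K1⁶ (`K1Skeleton13SepCoPRv4.lean` 02cbd13c2df4f6a9) — and its rev-24 image
K1⁷ `StabilityBAtRecordR13SepCoPH` by the pure token map T₇ (plan g71 IMPACT-183 §A: `Stage13RParams ↦ Stage13HParams`, `Provisos₁₃SepCoPR ↦ Provisos₁₃SepCoPH`, `ZrUnity ↦ ZhUnity`,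
`datumOfRecord₁₃SepCoPR ↦ datumOfRecord₁₃SepCoPH`) — binds its world to the **S-BOUND** record class `RecordS F θ h w` := node00-def-T's `IsRecordOfRecord₁₃CSepCoPH` AT THE PRESENTING PAIR
`(θ, h)` with ONE token changed, `upOfRecord₅C ↦ upOfRecord₅CS` (node00-def `Node00/CarriersB8.lean` :288 — the C-binding with its `b8` block re-bound in the SURVIVING form `B8LeafRS`; every
other leaf untouched, `rfl`).  `RecordS` is skeleton-local — so, exactly as at v1.6 (p534364) and as dag-n08-c's ∕ dag-n12-d's slices do, the class is spelled INLINE here, verbatim at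
general `N`.  This seat's storey `…N10AtRecord13SepCoPHB13` is the C-BOUND reading; this file is the S-BOUND one the rung reads.  §1 the S-faces at the [B13]-pinned v1.7 view: the
S-binding re-binds `b8` only and the [B13] pin re-binds `res.X` only, so N10 reads THE SAME LEAF `B13LeafOfRecord θ₃ (lam P)` (def-B13's Stage-5 face `b13_main_iff_rebindX_XB13OfRecordS` along
this seat's `Stage13HParams.toStage5₁₃CoPH_pinB13`).  §2 for ANY admissible v1.7 package `θ : Stage13HParams` with the v1.7 provisos and ANY per-run [B13] layer carrying the leaf at every
run, the world S-bound over `(θ.pinB13 lam13).toStage5₁₃CoPH` is in `RecordS F θ h ·` (presenting pair `(θ.pinB13 lam13, h.pinB13 lam13)`: admissibility `Iff.rfl`, datum `rfl` UP-SIDE by this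
seat's `datumOfRecord₁₃SepCoPH_pinB13`) with `Dag.B13_main` at every run; the family currency; the rung-1 ∃-shape restricted to N10's conjunct; and the `N = 2` form from the K0⁷ BODY at `F`
(T₇ of the K0⁶ body, VERBATIM) plus the DISPLAYED N10 obligation «at every admissible v1.7 package some [B13] layer carries the leaf at every run».  §3 THE ⁷ WITNESS LINE: at def-T's door
`Stage13HParams.ofHistoryBlind θ₆` (FILE 27: `⟨θ₆, fun p _ _ _ => θ₆.Zr p, fun p _ _ _ => (θ₆.Rz p.K).phi⟩`) of ANY admissible v1.6 package `θ₆ : Stage13RParams` with `Provisos₁₃SepCoPR` and the ⁶ guard `ZrUnity ∧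
SlotsNondegenerate₁₃`, the ⁷ guard's `ZhUnity` comes from `ZrUnity` (def-T's `ZrUnity.ofHistoryBlind`), the v1.7 provisos from `Provisos₁₃SepCoPR.ofHistoryBlind`, admissibility and the slot
guard are `θ₆`'s definitionally, and §2 applies — S-bound and (via the C-bound storey) C-bound; COMPOSED with node00-def-K0a's cured lift `Stage13RParams.ofCured θ₀`
(`Node00/Record13SepCoPRInhabitedOfSepCoP.lean` :102; `zrUnity_ofCured` hypothesis-free) the line starts at ANY admissible v1.5 package `θ₀ : Stage13Params` with `Provisos₁₃SepCoP` and
non-degenerate slots — every K0⁷ inhabitant of record reached through the door is such a lift (plan g71 IMPACT-183 §A «K0⁷ ⟸ K0⁶ by the door»).  §4 HONESTY (R433 species): the S-bound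
∃-currency is junk-dischargeable through def-B13's ZERO term tower at EVERY package, exactly as the C-bound one — so the displayed N10 obligation of §2's `N = 2` form is VACUOUSLY inhabited
as typed; content enters only when `lam13` is the term tower OF RECORD with the leaf supplied from located inputs that are THEOREMS about that tower (dag-n10-c's lane: (2.26) per term ∕
`UniformWalksAcross` for Bałaban's kernels).  NOT the stub `stub_nodes13PWS` (which wants all thirteen nodes, N08 and N12 pinned, at ONE world); NOT a discharge; nothing of Bałaban's
asserted; N10 NOT discharged; a re-key is not progress; no count moves (typed 28∕28 · discharged 5∕27); one finite four-torus programme at fixed ε = L^{−K} per run; nothing continuum ∕ ℝ⁴ ∕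
OS ∕ mass-gap ∕ Clay.  0 `sorry`, 0 `def`, standard axioms.  Filed `--kind proof --supports stmt-QuantumFields-20507 --as helper` (K1⁶ until KEY-24 ∕ WORDS-143 name K1⁷; MIS-KEY rule).

WHAT THIS FILE PROVES.  §1 `b13_main_iff_upS_toStage5₁₃CoPH_pinB13`, `b13_leaf_iff_upS_toStage5₁₃CoPH_pinB13`, `b13_main_of_upS_pinB13`;
§2 `exists_worldS₁₃CSepCoPH_pinB13_b13_main_of_leafOfRecord`, `exists_worldS₁₃CSepCoPH_pinB13_b13_main_of_famLeafOfRecord`, `exists_guarded_recordS₁₃CSepCoPH_b13_main_of_leafOfRecord`,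
`exists_guarded_recordS₁₃CSepCoPH_b13_main_of_inhabited13_two`; §3 `exists_worldS₁₃CSepCoPH_b13_main_at_ofHistoryBlind_of_leafOfRecord`,
`exists_guarded_recordS₁₃CSepCoPH_b13_main_at_ofHistoryBlind_of_leafOfRecord`, `exists_guarded_recordS₁₃CSepCoPH_b13_main_at_ofHistoryBlind_ofCured_of_leafOfRecord`,
`exists_guarded_record₁₃CSepCoPH_b13_main_at_ofHistoryBlind_of_leafOfRecord`; §4 `exists_worldS₁₃CSepCoPH_b13_main_of_zeroTower`, `n10_obligation_two_of_zeroTower`.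
-/

namespace Summit.QuantumFields.YangMills.BalabanUVNodes.N10AtRecord13SepCoPHSB13

open Literature.MathematicalPhysics.QuantumFieldTheory.Balaban1983to89
open Literature.MathematicalPhysics.QuantumFieldTheory.Balaban1983to89.T4Continuum
open Literature.MathematicalPhysics.QuantumFieldTheory.Balaban1983to89.DagBinding
open Literature.MathematicalPhysics.QuantumFieldTheory.Balaban1983to89.Node00
open scoped Matrix.Norms.L2Operator

/-! ## §1. The S-faces: N10 at a run S-bound over the [B13]-pinned v1.7 view reads the same leaf -/

section FacesS

variable {F : T4Family} {N : ℕ} [NeZero N]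

/-- **N10 AT A RUN S-BOUND OVER THE [B13]-PINNED STAGE-13 `CoPH` VIEW**: «b9 → b10 → b11 → b12 → b13» with `b13` THE LEAF AT THE GROUP OF RECORD, the in-edges at `θ`'s residual
carriers — def-B13's `b13_main_iff_rebindX_XB13OfRecordS` (the S-binding re-binds `b8` only; N10 does not read `b8`) at `φ := θ.toStage5₁₃CoPH` along `toStage5₁₃CoPH_pinB13`.
[cite: Balaban1988RG2Cluster, Lemmas 1–3 pp.9, 11, 20 (the node at the objects of record); Balaban1985RegularSpaces, Thm 8 p.101 (the S-binding's `b8`; bookkeeping)] -/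
theorem b13_main_iff_upS_toStage5₁₃CoPH_pinB13 (θ : Stage13HParams F N) (lam : B12.RunParams → ResidB13 θ.toStage3Params) (w : WorldP) (P : B12.RunParams)
    (hup : w.up P = upOfRecord₅CS F N ((θ.pinB13 F N lam).toStage5₁₃CoPH F N) P) :
    Dag.B13_main (leavesP w P) ↔
      (B9LeafX (θ.res.Y P) → (B10.Thm1PrintedCompact (θ.res.X P).runs10 ∧ B10.Thm2Printed (θ.res.X P).runs10) → B11Leaf (θ.res.Z P) →
        B12Sec2to5.Lemma4Printed (θ.res.X P).F12 (θ.res.X P).c12 → B13LeafOfRecord θ.toStage3Params (lam P)) := by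
  rw [Stage13HParams.toStage5₁₃CoPH_pinB13] at hup
  exact b13_main_iff_rebindX_XB13OfRecordS (θ.toStage5₁₃CoPH F N) lam θ.res.X w P hup

/-- The leaf alone under the S-binding: `(leavesP w P).b13 ↔ B13LeafOfRecord θ₃ (lam P)` (`Iff.rfl` once `w.up P` is rewritten). [cite: Balaban1988RG2Cluster, Lemmas 1–3 pp.9, 11, 20 (bookkeeping)] -/
theorem b13_leaf_iff_upS_toStage5₁₃CoPH_pinB13 (θ : Stage13HParams F N) (lam : B12.RunParams → ResidB13 θ.toStage3Params) (w : WorldP) (P : B12.RunParams)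
    (hup : w.up P = upOfRecord₅CS F N ((θ.pinB13 F N lam).toStage5₁₃CoPH F N) P) :
    (leavesP w P).b13 ↔ B13LeafOfRecord θ.toStage3Params (lam P) := by
  rw [Stage13HParams.toStage5₁₃CoPH_pinB13] at hup
  show (w.up P).b13 ↔ _
  rw [hup]
  exact Iff.rfl

/-- **N10 AT EVERY RUN OF A WORLD S-BOUND OVER THE [B13]-PINNED v1.7 VIEW, FROM THE LEAF AT EVERY RUN.** [cite: Balaban1988RG2Cluster, Lemma 1 p.9, Lemma 2 p.11, Lemma 3 p.20] -/
theorem b13_main_of_upS_pinB13 {θ : Stage13HParams F N} {lam : B12.RunParams → ResidB13 θ.toStage3Params} {w : WorldP}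
    (hup : ∀ P, w.up P = upOfRecord₅CS F N ((θ.pinB13 F N lam).toStage5₁₃CoPH F N) P) (hleaf : ∀ P, B13LeafOfRecord θ.toStage3Params (lam P))
    (P : B12.RunParams) : Dag.B13_main (leavesP w P) :=
  (b13_main_iff_upS_toStage5₁₃CoPH_pinB13 θ lam w P (hup P)).2 fun _ _ _ _ => hleaf P

end FacesS

/-! ## §2. The S-bound world in plan's `RecordS F θ h ·` (inlined) with `Dag.B13_main` at every run; the rung-1 v4 ∃-shape, N10's conjunct -/

section RungSliceS

variable (F : T4Family) (N : ℕ) [NeZero N]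

/-- **FOR ANY ADMISSIBLE v1.7 PACKAGE `θ : Stage13HParams` WITH THE v1.7 PROVISOS AND ANY PER-RUN [B13] LAYER CARRYING THE LEAF AT EVERY RUN, THE WORLD S-BOUND OVER THE [B13]-PINNED
STAGE-13 VIEW (window `γw ∈ ]0, θ.γ]`, block size `θ.L`) IS IN plan's S-BOUND RECORD CLASS `RecordS F θ h ·` OF THE REGISTERED RUNG 1 v4 — INLINED: presenting pair
`(θ.pinB13 lam13, h.pinB13 lam13)`, admissibility read at it, THE SAME v1.7 datum (`datumOfRecord₁₃SepCoPH_pinB13`, UP-SIDE), the S-binding of record over `(θ.pinB13 lam13).toStage5₁₃CoPH`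
— WITH `Dag.B13_main` AT EVERY RUN.**  N10's conjunct modulo the leaf and the other nodes at the SAME world.  Count-neutral.
[cite: Balaban1988RG2Cluster, Lemmas 1–3 pp.9, 11, 20; Balaban1989LargeFieldII, Thm 1 + (0.1) pp.355–356; Balaban1988Convergent, (2.18) p.257, (2.28) p.259 (the record); Balaban1985RegularSpaces, Thm 8 p.101 (bookkeeping)] -/
theorem exists_worldS₁₃CSepCoPH_pinB13_b13_main_of_leafOfRecord (θ : Stage13HParams F N) (h : θ.Provisos₁₃SepCoPH F N) (hθ : θ.Admissible F N)
    (lam13 : B12.RunParams → ResidB13 θ.toStage3Params) {γw : ℝ} (hγw : 0 < γw ∧ γw ≤ θ.γ)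
    (hleaf : ∀ P, B13LeafOfRecord θ.toStage3Params (lam13 P)) :
    ∃ w : WorldP,
      (∃ (θ' : Stage13HParams F N) (h' : θ'.Provisos₁₃SepCoPH F N), θ'.Admissible F N ∧
        datumOfRecord₁₃SepCoPH F N θ h = datumOfRecord₁₃SepCoPH F N θ' h' ∧ w.C = (datumOfRecord₁₃SepCoPH F N θ h).C ∧ (0 < w.γ ∧ w.γ ≤ θ'.γ) ∧
        w.L = (θ'.L : ℝ) ∧ ∀ P : B12.RunParams, w.up P = upOfRecord₅CS F N (θ'.toStage5₁₃CoPH F N) P) ∧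
      w.γ = γw ∧ w.L = (θ.L : ℝ) ∧ (∀ P, w.up P = upOfRecord₅CS F N ((θ.pinB13 F N lam13).toStage5₁₃CoPH F N) P) ∧
        ∀ P : B12.RunParams, Dag.B13_main (leavesP w P) := by
  obtain ⟨w₀⟩ := nonempty_worldP
  refine ⟨{ w₀ with
      C := (datumOfRecord₁₃SepCoPH F N θ h).C, γ := γw, L := (θ.L : ℝ), one_lt_L := by exact_mod_cast θ.hL.2,
      up := fun P => upOfRecord₅CS F N ((θ.pinB13 F N lam13).toStage5₁₃CoPH F N) P },
    ⟨θ.pinB13 F N lam13, h.pinB13 lam13, (Stage13Params.pinB13_admissible_iff F N θ.toStage13Params lam13).2 hθ, (datumOfRecord₁₃SepCoPH_pinB13 F N θ h lam13).symm, rfl, hγw,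
      rfl, fun _ => rfl⟩, rfl, rfl, fun _ => rfl, ?_⟩
  exact b13_main_of_upS_pinB13 (fun _ => rfl) hleaf

/-- **THE SAME IN THE FAMILY CURRENCY** (def-B13 g3's member bridge `b13LeafOfRecord_member₁₂` read at `θ.toStage12Params`): for any Stage-12∕13 [B13] family carrying the family leaf of
record at EVERY run and any per-run SELECTION of a box member with the letters of record, the world S-bound over the view [B13]-PINNED AT THE SELECTED MEMBERS is in `RecordS F θ h ·` with
`Dag.B13_main` at every run. [cite: Balaban1988RG2Cluster, Lemmas 1–3 pp.9, 11, 20; Balaban1987RG1, Thm 3 p.264; Balaban1989LargeFieldII, Thm 1 + (0.1) pp.355–356 (bookkeeping)] -/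
theorem exists_worldS₁₃CSepCoPH_pinB13_b13_main_of_famLeafOfRecord (θ : Stage13HParams F N) (h : θ.Provisos₁₃SepCoPH F N) (hθ : θ.Admissible F N) {γw : ℝ}
    (hγw : 0 < γw ∧ γw ≤ θ.γ) (c : B13.Consts) (lamF : ResidB13Fam₁₂ F N θ.toStage12Params)
    (hleaf : ∀ P, B13FamLeafOfRecord₁₂ F N θ.toStage12Params c lamF P) (κ : B12.RunParams → ℕ) (ν : (P : B12.RunParams) → Fin (κ P + 1) → ℝ)
    (hν : ∀ P, ν P ∈ FlowStep.Box θ.γ (κ P)) (hc : ∀ P, (lamF P (κ P) (ν P)).c = c13OfRecord₁₂ F N θ.toStage12Params c) :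
    ∃ w : WorldP,
      (∃ (θ' : Stage13HParams F N) (h' : θ'.Provisos₁₃SepCoPH F N), θ'.Admissible F N ∧
        datumOfRecord₁₃SepCoPH F N θ h = datumOfRecord₁₃SepCoPH F N θ' h' ∧ w.C = (datumOfRecord₁₃SepCoPH F N θ h).C ∧ (0 < w.γ ∧ w.γ ≤ θ'.γ) ∧
        w.L = (θ'.L : ℝ) ∧ ∀ P : B12.RunParams, w.up P = upOfRecord₅CS F N (θ'.toStage5₁₃CoPH F N) P) ∧
      w.γ = γw ∧ w.L = (θ.L : ℝ) ∧ (∀ P, w.up P = upOfRecord₅CS F N ((θ.pinB13 F N fun P => lamF P (κ P) (ν P)).toStage5₁₃CoPH F N) P) ∧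
        ∀ P : B12.RunParams, Dag.B13_main (leavesP w P) :=
  exists_worldS₁₃CSepCoPH_pinB13_b13_main_of_leafOfRecord F N θ h hθ (fun P => lamF P (κ P) (ν P)) hγw
    fun P => b13LeafOfRecord_member₁₂ (hleaf P) (hν P) (hc P)

/-- **THE REGISTERED RUNG 1 v4 `NodesAtSomeRecord13PWS` RESTRICTED TO N10's CONJUNCT, at general `N`, WITNESSED BY `(θ, h, w)` FOR EVERY GUARDED ADMISSIBLE v1.7 PACKAGE given the
leaf at a per-run [B13] layer**: `∃ θ h w, (ZhUnity ∧ SlotsNondegenerate₁₃) ∧ Admissible ∧ RecordS F θ h w ∧ ∀ P, Dag.B13_main (leavesP w P)` (`RecordS` inlined; window `θ.γ`).  N10 ALONE at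
its own S-bound world — the joint rung needs all thirteen nodes, N08 and N12 pinned, at ONE world (dag-n24-c's S-bound four-pin engine; N10's socket there IS the leaf).  NOT the stub; count-neutral.
[cite: Balaban1988RG2Cluster, Lemmas 1–3 pp.9, 11, 20; Balaban1989LargeFieldII, Thm 1 + (0.1) pp.355–356; Balaban1988Convergent, (3.16)–(3.22) pp.268–269 (the guard; bookkeeping)] -/
theorem exists_guarded_recordS₁₃CSepCoPH_b13_main_of_leafOfRecord (θ : Stage13HParams F N) (h : θ.Provisos₁₃SepCoPH F N) (hU : θ.ZhUnity F N ∧ θ.SlotsNondegenerate₁₃ F N)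
    (hθ : θ.Admissible F N) (lam13 : B12.RunParams → ResidB13 θ.toStage3Params) (hleaf : ∀ P, B13LeafOfRecord θ.toStage3Params (lam13 P)) :
    ∃ (θ : Stage13HParams F N) (h : θ.Provisos₁₃SepCoPH F N) (w : WorldP), (θ.ZhUnity F N ∧ θ.SlotsNondegenerate₁₃ F N) ∧ θ.Admissible F N ∧
      (∃ (θ' : Stage13HParams F N) (h' : θ'.Provisos₁₃SepCoPH F N), θ'.Admissible F N ∧
        datumOfRecord₁₃SepCoPH F N θ h = datumOfRecord₁₃SepCoPH F N θ' h' ∧ w.C = (datumOfRecord₁₃SepCoPH F N θ h).C ∧ (0 < w.γ ∧ w.γ ≤ θ'.γ) ∧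
        w.L = (θ'.L : ℝ) ∧ ∀ P : B12.RunParams, w.up P = upOfRecord₅CS F N (θ'.toStage5₁₃CoPH F N) P) ∧
      ∀ P : B12.RunParams, Dag.B13_main (leavesP w P) := by
  obtain ⟨w, hR, -, -, -, hN⟩ := exists_worldS₁₃CSepCoPH_pinB13_b13_main_of_leafOfRecord F N θ h hθ lam13 ⟨hθ.toStage9.gamma_pos, le_rfl⟩ hleaf
  exact ⟨θ, h, w, hU, hθ, hR, hN⟩

/-- **«THE K0⁶ ANTECEDENT ⟹ N10's SLICE OF THE REGISTERED RUNG 1 v4», `N = 2`**: from `∃ θ, Provisos₁₃SepCoPH ∧ (ZhUnity ∧ SlotsNondegenerate₁₃) ∧ Admissible` at `F` (HYPOTHESIS `hI` = the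
K0⁶ body at `F` VERBATIM, rung 0 `Inhabited13 F`) and THE DISPLAYED N10 OBLIGATION `hN10` «at every admissible v1.7 package with the provisos, SOME per-run [B13] layer carries the leaf of record at
every run» (N10's object content when the layer is the term tower OF RECORD — dag-n10-c's lane; VACUOUSLY inhabited at def-B13's zero tower, §4): SOME guarded admissible `θ`, provisos `h` and
world `w` with `RecordS F θ h w` (inlined) and `Dag.B13_main` at every run — rung 1 v4's text with the twelve other node conjuncts, the N08 pin and the N12 selector conjunct removed.
NOT the stub, NOT a discharge. [cite: Balaban1988RG2Cluster, Lemmas 1–3 pp.9, 11, 20; Balaban1989LargeFieldII, Thm 1 + (0.1) pp.355–356; Balaban1988Convergent, (3.16)–(3.22) pp.268–269 (bookkeeping)] -/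
theorem exists_guarded_recordS₁₃CSepCoPH_b13_main_of_inhabited13_two (F : T4Family)
    (hI : ∃ θ : Stage13HParams F 2, θ.Provisos₁₃SepCoPH F 2 ∧ (θ.ZhUnity F 2 ∧ θ.SlotsNondegenerate₁₃ F 2) ∧ θ.Admissible F 2)
    (hN10 : ∀ θ : Stage13HParams F 2, θ.Provisos₁₃SepCoPH F 2 → θ.Admissible F 2 →
      ∃ lam13 : B12.RunParams → ResidB13 θ.toStage3Params, ∀ P, B13LeafOfRecord θ.toStage3Params (lam13 P)) :
    ∃ (θ : Stage13HParams F 2) (h : θ.Provisos₁₃SepCoPH F 2) (w : WorldP), (θ.ZhUnity F 2 ∧ θ.SlotsNondegenerate₁₃ F 2) ∧ θ.Admissible F 2 ∧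
      (∃ (θ' : Stage13HParams F 2) (h' : θ'.Provisos₁₃SepCoPH F 2), θ'.Admissible F 2 ∧
        datumOfRecord₁₃SepCoPH F 2 θ h = datumOfRecord₁₃SepCoPH F 2 θ' h' ∧ w.C = (datumOfRecord₁₃SepCoPH F 2 θ h).C ∧ (0 < w.γ ∧ w.γ ≤ θ'.γ) ∧
        w.L = (θ'.L : ℝ) ∧ ∀ P : B12.RunParams, w.up P = upOfRecord₅CS F 2 (θ'.toStage5₁₃CoPH F 2) P) ∧
      ∀ P : B12.RunParams, Dag.B13_main (leavesP w P) := by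
  obtain ⟨θ, h, hU, hθ⟩ := hI
  obtain ⟨lam13, hleaf⟩ := hN10 θ h hθ
  exact exists_guarded_recordS₁₃CSepCoPH_b13_main_of_leafOfRecord F 2 θ h hU hθ lam13 hleaf

end RungSliceS

/-! ## §3. THE ⁷ WITNESS LINE: N10's slice at node00-def-T's door `Stage13HParams.ofHistoryBlind θ₆` of ANY guarded v1.6 package, and at the door of node00-def-K0a's cured lift
`ofHistoryBlind (ofCured θ₀)` of ANY v1.5 package — the guard's `ZhUnity` DISCHARGED from `ZrUnity` ∕ from K0a's `zrUnity_ofCured` -/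

section WitnessLine

variable (F : T4Family) (N : ℕ) [NeZero N]

/-- **AT def-T's DOOR `ofHistoryBlind θ₆` OF ANY ADMISSIBLE v1.6 PACKAGE `θ₆ : Stage13RParams` WITH THE v1.6 SEPARATED-RANGE PROVISOS, given a per-run [B13] layer OF `θ₆` carrying the leaf at
every run: a world S-bound over the [B13]-pinned door view, IN `RecordS F (ofHistoryBlind θ₆) h₆.ofHistoryBlind ·` (inlined), window `γw`, block size `θ₆.L`, with `Dag.B13_main` at every run** —
§2 at `θ := ofHistoryBlind θ₆` (`(ofHistoryBlind θ₆).toStage13RParams = θ₆`, `rfl`; the v1.7 provisos by def-T's `Provisos₁₃SepCoPR.ofHistoryBlind`; admissibility is read through `toStage13Params`, definitionally `θ₆`'s).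
[cite: Balaban1988RG2Cluster, Lemmas 1–3 pp.9, 11, 20; Balaban1988Convergent, p.257, p.267, (3.23) p.270 (the history-blind slot at the door; bookkeeping); Balaban1989LargeFieldII, Thm 1 + (0.1) pp.355–356] -/
theorem exists_worldS₁₃CSepCoPH_b13_main_at_ofHistoryBlind_of_leafOfRecord (θ₆ : Stage13RParams F N) (h₆ : θ₆.Provisos₁₃SepCoPR F N) (hθ : θ₆.Admissible F N)
    (lam13 : B12.RunParams → ResidB13 θ₆.toStage3Params) {γw : ℝ} (hγw : 0 < γw ∧ γw ≤ θ₆.γ) (hleaf : ∀ P, B13LeafOfRecord θ₆.toStage3Params (lam13 P)) :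
    ∃ w : WorldP,
      (∃ (θ' : Stage13HParams F N) (h' : θ'.Provisos₁₃SepCoPH F N), θ'.Admissible F N ∧
        datumOfRecord₁₃SepCoPH F N (Stage13HParams.ofHistoryBlind F N θ₆) h₆.ofHistoryBlind = datumOfRecord₁₃SepCoPH F N θ' h' ∧
        w.C = (datumOfRecord₁₃SepCoPH F N (Stage13HParams.ofHistoryBlind F N θ₆) h₆.ofHistoryBlind).C ∧ (0 < w.γ ∧ w.γ ≤ θ'.γ) ∧
        w.L = (θ'.L : ℝ) ∧ ∀ P : B12.RunParams, w.up P = upOfRecord₅CS F N (θ'.toStage5₁₃CoPH F N) P) ∧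
      w.γ = γw ∧ w.L = (θ₆.L : ℝ) ∧ (∀ P, w.up P = upOfRecord₅CS F N (((Stage13HParams.ofHistoryBlind F N θ₆).pinB13 F N lam13).toStage5₁₃CoPH F N) P) ∧
        ∀ P : B12.RunParams, Dag.B13_main (leavesP w P) :=
  exists_worldS₁₃CSepCoPH_pinB13_b13_main_of_leafOfRecord F N (Stage13HParams.ofHistoryBlind F N θ₆) h₆.ofHistoryBlind hθ lam13 hγw hleaf

/-- **★ THE RUNG-1 ∃-SHAPE (v1.7 tokens), N10's CONJUNCT, WITNESSED AT THE DOOR OF ANY GUARDED ADMISSIBLE v1.6 PACKAGE — THE ⁷ GUARD's `ZhUnity` FROM THE ⁶ GUARD's `ZrUnity`** (def-T's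
`ZrUnity.ofHistoryBlind`; `SlotsNondegenerate₁₃` and admissibility are `θ₆`'s definitionally at the door), given the leaf at a per-run [B13] layer of `θ₆`; the conjunct `θ.toStage13RParams = θ₆` is displayed.
This is the N10 row of the ⁶ → ⁷ port: every history-blind K1⁶-side N10 statement holds at the door verbatim («nothing is lost», director-ym №183 (3)).  NOT the stub; count-neutral.
[cite: Balaban1988RG2Cluster, Lemmas 1–3 pp.9, 11, 20; Balaban1988Convergent, (3.16)–(3.22) pp.268–269, p.267 (the guard; bookkeeping); Balaban1989LargeFieldII, Thm 1 + (0.1) pp.355–356] -/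
theorem exists_guarded_recordS₁₃CSepCoPH_b13_main_at_ofHistoryBlind_of_leafOfRecord (θ₆ : Stage13RParams F N) (h₆ : θ₆.Provisos₁₃SepCoPR F N)
    (hU : θ₆.ZrUnity F N ∧ θ₆.SlotsNondegenerate₁₃ F N) (hθ : θ₆.Admissible F N) (lam13 : B12.RunParams → ResidB13 θ₆.toStage3Params)
    (hleaf : ∀ P, B13LeafOfRecord θ₆.toStage3Params (lam13 P)) :
    ∃ (θ : Stage13HParams F N) (h : θ.Provisos₁₃SepCoPH F N) (w : WorldP), θ.toStage13RParams = θ₆ ∧ (θ.ZhUnity F N ∧ θ.SlotsNondegenerate₁₃ F N) ∧ θ.Admissible F N ∧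
      (∃ (θ' : Stage13HParams F N) (h' : θ'.Provisos₁₃SepCoPH F N), θ'.Admissible F N ∧
        datumOfRecord₁₃SepCoPH F N θ h = datumOfRecord₁₃SepCoPH F N θ' h' ∧ w.C = (datumOfRecord₁₃SepCoPH F N θ h).C ∧ (0 < w.γ ∧ w.γ ≤ θ'.γ) ∧
        w.L = (θ'.L : ℝ) ∧ ∀ P : B12.RunParams, w.up P = upOfRecord₅CS F N (θ'.toStage5₁₃CoPH F N) P) ∧
      ∀ P : B12.RunParams, Dag.B13_main (leavesP w P) := by
  obtain ⟨w, hR, -, -, -, hN⟩ :=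
    exists_worldS₁₃CSepCoPH_b13_main_at_ofHistoryBlind_of_leafOfRecord F N θ₆ h₆ hθ lam13 ⟨hθ.toStage9.gamma_pos, le_rfl⟩ hleaf
  exact ⟨Stage13HParams.ofHistoryBlind F N θ₆, h₆.ofHistoryBlind, w, rfl, ⟨hU.1.ofHistoryBlind, hU.2⟩, hθ, hR, hN⟩

/-- **★ … AND AT THE DOOR OF node00-def-K0a's CURED LIFT `ofHistoryBlind (ofCured θ₀)` OF ANY ADMISSIBLE v1.5 PACKAGE `θ₀ : Stage13Params` WITH `Provisos₁₃SepCoP` AND NON-DEGENERATE SLOTS —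
THE GUARD's `ZhUnity` DISCHARGED** (K0a's hypothesis-free `zrUnity_ofCured`, FILE 17 `finsum_ζ0_ZrOfRecord₁₃`, carried through the door; `SlotsNondegenerate₁₃` and admissibility are `θ₀`'s,
`Iff.rfl` twice), given the leaf at a per-run [B13] layer of `θ₀`; the conjunct `θ.toStage13Params = θ₀` is displayed.  This is the N10 row of the ⁷ witness line: every K0⁷ inhabitant of record
reached through the door (plan g71 IMPACT-183 §A «K0⁷ ⟸ K0⁶ by the door»; K0a `Record13SepCoPRInhabited_of`) is such a lift.  NOT the stub; count-neutral.
[cite: Balaban1988RG2Cluster, Lemmas 1–3 pp.9, 11, 20; Balaban1988Convergent, (1.11) p.248, (3.16)–(3.22) pp.268–269, p.267; Balaban1989LargeFieldII, Thm 1 + (0.1) pp.355–356 (bookkeeping)] -/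
theorem exists_guarded_recordS₁₃CSepCoPH_b13_main_at_ofHistoryBlind_ofCured_of_leafOfRecord (θ₀ : Stage13Params F N) (h₀ : θ₀.Provisos₁₃SepCoP F N)
    (hS : θ₀.SlotsNondegenerate₁₃ F N) (hθ : θ₀.Admissible F N) (lam13 : B12.RunParams → ResidB13 θ₀.toStage3Params)
    (hleaf : ∀ P, B13LeafOfRecord θ₀.toStage3Params (lam13 P)) :
    ∃ (θ : Stage13HParams F N) (h : θ.Provisos₁₃SepCoPH F N) (w : WorldP), θ.toStage13Params = θ₀ ∧ (θ.ZhUnity F N ∧ θ.SlotsNondegenerate₁₃ F N) ∧ θ.Admissible F N ∧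
      (∃ (θ' : Stage13HParams F N) (h' : θ'.Provisos₁₃SepCoPH F N), θ'.Admissible F N ∧
        datumOfRecord₁₃SepCoPH F N θ h = datumOfRecord₁₃SepCoPH F N θ' h' ∧ w.C = (datumOfRecord₁₃SepCoPH F N θ h).C ∧ (0 < w.γ ∧ w.γ ≤ θ'.γ) ∧
        w.L = (θ'.L : ℝ) ∧ ∀ P : B12.RunParams, w.up P = upOfRecord₅CS F N (θ'.toStage5₁₃CoPH F N) P) ∧
      ∀ P : B12.RunParams, Dag.B13_main (leavesP w P) := by
  obtain ⟨θ, h, w, hθ₀, hU, hA, hR, hN⟩ :=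
    exists_guarded_recordS₁₃CSepCoPH_b13_main_at_ofHistoryBlind_of_leafOfRecord F N (Stage13RParams.ofCured F N θ₀) h₀.ofCured
      ⟨Stage13RParams.zrUnity_ofCured θ₀, Stage13RParams.slotsNondegenerate₁₃_ofCured_iff.2 hS⟩ (Stage13RParams.admissible_ofCured_iff.2 hθ) lam13 hleaf
  exact ⟨θ, h, w, congrArg Stage13RParams.toStage13Params hθ₀, hU, hA, hR, hN⟩

/-- **The C-BOUND twin at the door** (this seat's storey `N10AtRecord13SepCoPHB13.exists_record₁₃CSepCoPH_pinB13World_b13_main_of_leafOfRecord` at `θ := ofHistoryBlind θ₆`, guard ported the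
same way): a guarded admissible v1.7 package over `θ₆`, a `IsRecordOfRecord₁₃CSepCoPH` record of its own v1.7 datum, `Dag.B13_main` at every run.
[cite: Balaban1988RG2Cluster, Lemmas 1–3 pp.9, 11, 20; Balaban1988Convergent, (3.16)–(3.22) pp.268–269; Balaban1989LargeFieldII, Thm 1 + (0.1) pp.355–356 (bookkeeping)] -/
theorem exists_guarded_record₁₃CSepCoPH_b13_main_at_ofHistoryBlind_of_leafOfRecord (θ₆ : Stage13RParams F N) (h₆ : θ₆.Provisos₁₃SepCoPR F N)
    (hU : θ₆.ZrUnity F N ∧ θ₆.SlotsNondegenerate₁₃ F N) (hθ : θ₆.Admissible F N) (lam13 : B12.RunParams → ResidB13 θ₆.toStage3Params)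
    (hleaf : ∀ P, B13LeafOfRecord θ₆.toStage3Params (lam13 P)) :
    ∃ (θ : Stage13HParams F N) (h : θ.Provisos₁₃SepCoPH F N) (w : WorldP), θ.toStage13RParams = θ₆ ∧ (θ.ZhUnity F N ∧ θ.SlotsNondegenerate₁₃ F N) ∧ θ.Admissible F N ∧
      IsRecordOfRecord₁₃CSepCoPH F N (datumOfRecord₁₃SepCoPH F N θ h) w ∧ ∀ P : B12.RunParams, Dag.B13_main (leavesP w P) := by
  obtain ⟨w, hR, -, -, -, hN⟩ := N10AtRecord13SepCoPHB13.exists_record₁₃CSepCoPH_pinB13World_b13_main_of_leafOfRecord F N (Stage13HParams.ofHistoryBlind F N θ₆)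
    h₆.ofHistoryBlind hθ lam13 ⟨hθ.toStage9.gamma_pos, le_rfl⟩ hleaf
  exact ⟨Stage13HParams.ofHistoryBlind F N θ₆, h₆.ofHistoryBlind, w, rfl, ⟨hU.1.ofHistoryBlind, hU.2⟩, hθ, hR, hN⟩

end WitnessLine

/-! ## §4. HONESTY (R433 species): the S-bound ∃-currency, like the C-bound one, is junk-dischargeable through def-B13's zero term tower -/

section Honesty

variable (F : T4Family) (N : ℕ) [NeZero N]

/-- **N10's CONJUNCT OF THE S-BOUND RUNG IS JUNK-DISCHARGEABLE IN THE ∃-CURRENCY, AT EVERY v1.7 PACKAGE WITH THE v1.7 PROVISOS** — §2 with `lam13 :=` def-B13's ZERO TERM TOWER WITH FULL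
SPACES (`Node00.exists_residB13_b13LeafOfRecord_univ`).  Content enters only when `lam13` is PINNED to a term tower OF RECORD with the leaf supplied from located inputs that are THEOREMS about
that tower (dag-n10-c's lane).  Count-neutral. [cite: Balaban1988RG2Cluster, (1.33) p.9, (1.41)–(1.42) p.11, (2.9)–(2.14) pp.14–15, Lemmas 1–3 pp.9, 11, 20] -/
theorem exists_worldS₁₃CSepCoPH_b13_main_of_zeroTower (θ : Stage13HParams F N) (h : θ.Provisos₁₃SepCoPH F N) (hθ : θ.Admissible F N) {γw : ℝ}
    (hγw : 0 < γw ∧ γw ≤ θ.γ) :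
    ∃ w : WorldP,
      (∃ (θ' : Stage13HParams F N) (h' : θ'.Provisos₁₃SepCoPH F N), θ'.Admissible F N ∧
        datumOfRecord₁₃SepCoPH F N θ h = datumOfRecord₁₃SepCoPH F N θ' h' ∧ w.C = (datumOfRecord₁₃SepCoPH F N θ h).C ∧ (0 < w.γ ∧ w.γ ≤ θ'.γ) ∧
        w.L = (θ'.L : ℝ) ∧ ∀ P : B12.RunParams, w.up P = upOfRecord₅CS F N (θ'.toStage5₁₃CoPH F N) P) ∧
      w.γ = γw ∧ w.L = (θ.L : ℝ) ∧ ∀ P : B12.RunParams, Dag.B13_main (leavesP w P) := by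
  obtain ⟨lam, -, -, -, hleaf⟩ := exists_residB13_b13LeafOfRecord_univ θ.toStage3Params
  obtain ⟨w, hR, hγ, hL, -, hN⟩ := exists_worldS₁₃CSepCoPH_pinB13_b13_main_of_leafOfRecord F N θ h hθ (fun _ => lam) hγw fun _ => hleaf
  exact ⟨w, hR, hγ, hL, hN⟩

/-- **… HENCE THE DISPLAYED N10 OBLIGATION `hN10` OF §2's `N = 2` FORM IS VACUOUSLY INHABITED AS TYPED** (at every Stage-13 package whatsoever, by the zero tower) — said so that no reader
takes `exists_guarded_recordS₁₃CSepCoPH_b13_main_of_inhabited13_two` for a reduction of N10 to K0⁶: it is the ∃-currency's bookkeeping shape only; N10's content is the leaf AT THE TERM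
TOWER OF RECORD. [cite: Balaban1988RG2Cluster, (1.33) p.9, Lemmas 1–3 pp.9, 11, 20 (bookkeeping)] -/
theorem n10_obligation_two_of_zeroTower (F : T4Family) (θ : Stage13HParams F 2) :
    ∃ lam13 : B12.RunParams → ResidB13 θ.toStage3Params, ∀ P, B13LeafOfRecord θ.toStage3Params (lam13 P) := by
  obtain ⟨lam, -, -, -, hleaf⟩ := exists_residB13_b13LeafOfRecord_univ θ.toStage3Params
  exact ⟨fun _ => lam, fun _ => hleaf⟩

end Honesty

end Summit.QuantumFields.YangMills.BalabanUVNodes.N10AtRecord13SepCoPHSB13
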